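import Mathlib
import HarnessLib
import Summits.Ventures.LatticeQCDFlow.Scaling.HypercontractiveTiltedMass
import Summits.Ventures.LatticeQCDFlow.Scaling.PathWorkMoments
import Literature.Analysis.ODE.OneSidedComparison

/-!
# HypercontractiveESSFloor — the work-MGF envelope and the ESS floor of the uniform switching
# protocol for HYPERCONTRACTIVE layers, WITHOUT sup-norm factors:
# `log E_F[e^{−t(W−ΔF)}] ≤ ½[t(t−1)]₊σ̄²/n + |t(t−1)|·ρe^{(2t²−2t+1)σ̄²/(2n²)}/(1−θ_t)·σ̄²/n`,
# `θ_t = ρ·e^{(6t²−8t+3)σ̄²/(4n²)}`; at `t = 2`: `ÊSS ≥ exp(−((1+θ)/(1−θ))·σ̄²/n)`, `θ = ρe^{11σ̄²/(4n²)}`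

HONEST FRAMING: exact (Metropolis-corrected) sampling algorithms for lattice gauge theory;
figures of merit are autocorrelation/cost numbers at stated couplings and volumes; no
continuum-physics claim.

Venture `LatticeQCDFlow` (cell pub-lqcd), topic `Scaling`; FANOUT row 19 (`su2-snf`, GEN-10).
OUR WORK (elementary finite sums), nothing cited as a fact.  Setting: finite configuration space,
`S_c = S₀ + c•D`, uniform grid `c_k = k/n`, POSITIVE layers `P k` with unit row sums leaving
`π_{(k+1)/n}` invariant and HYPERCONTRACTIVE towards it with constant `ρ ≥ 0`
(`HyperContracts`, `Scaling/HypercontractiveDeviation`: zero-mass `L²(1/π)` deviations are mapped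
to `L⁴(π)` deviation densities with norm `ρ`; for reversible layers `‖P_k h‖_{L⁴} ≤ ρ‖h‖_{L²}` on
mean-zero `h`); `Var_c(D) ≤ σ̄²` for all `c`; `ΔF = F(1) − F(0)`.  NO HYPOTHESIS ON THE
OSCILLATION `ΔD` of the switch observable.

* the tilted-mass bound `|ν_n^{(t)}| ≤ p_n^{(t)}·exp(n·s·a/(1−θ))` (`s = √(e^{t²ε}−1)`,
  `a = ρ√(e^{(t−1)²ε}−1)`, `θ = ρe^{(6t²−8t+3)ε/4}`, `ε = σ̄²/n²`) is
  `Scaling/HypercontractiveTiltedMass` (`tTiltMass_uniform_le_hc`), the perfect part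
  `Σ_k Λ_k(t) ≤ ½[t(t−1)]₊σ̄²/n` is `Scaling/LinearFamilyStepMGF`;
* §1 `expMoment_work_uniform_le_hc_exact` (the perfect part `exp Σ_kΛ_k(t)` kept EXACT times the
  certified lag factor) and **`expMoment_work_uniform_le_hc` — THE MGF ENVELOPE** (display above; `e^x − 1 ≤ xe^x`
  folds `n·s·a` into `ρ|t(t−1)|e^{(2t²−2t+1)ε/2}σ̄²/n`): the Gaussian-type envelope of
  the `χ²` route (staged `WorkExponentialMoments`, `θ_t = ρe^{(5|t|+2|t−1|)ΔD/(4n)}`) with the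
  oscillation factor REPLACED by `e^{O(t²)σ̄²/n²}` — informative at every `n` with `θ_t < 1`;
  `relaxBudget_le` (`n·s·a ≤ ρ|t(t−1)|e^{(2t²−2t+1)ε/2}·σ̄²/n`, by the Literature's folklore
  `e^x − 1 ≤ xe^x`, `Literature/Analysis/ODE/OneSidedComparison`);
  CHERNOFF TAILS `lowerTail_work_le_hc` / `upperTail_work_le_hc` via `Scaling/PathWorkMoments`;
* §2 **`exp_le_ess_path_uniform_hc` — THE ESS FLOOR**: `ÊSS ≥ exp(−((1+θ)/(1−θ))·σ̄²/n)`,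
  `θ = ρ·e^{11σ̄²/(4n²)} < 1` — E7's printed law `−log ESS = k′n_dof/n_step`, `k′ = 2τ_intσ²`
  (`2τ_int = (1+ρ)/(1−ρ)`, the AR(1) dictionary of `Scaling/AR1SwitchingLaw`) as a CERTIFIED
  ENVELOPE whose only correction to `ρ` is `e^{11σ̄²/(4n²)}` (GEN-6 (d3) / GEN-9 (d3) answered for the
  exponential moments; the `χ²` route needed `ρe^{3ΔD/n} < 1`).

Reading (value-free): for layers that are hypercontractive with a margin (`ρ < 1`), the
reweighting ESS of NE-MCMC / SNF along the uniform protocol is at least `exp(−2τ̄σ̄²/n_step)` up to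
`1 + O(σ̄²/n_step²)` corrections in `τ̄ = ½(1+ρ)/(1−ρ)` — no dependence on the oscillation of the
defect action, so the statement is informative at production `n_step` (where `ΔD/n_step = O(1)`
made the `χ²`-route constants void).  On `ρ`: restricted to mean-zero deviations the `L² → L⁴`
constant can far exceed the spectral contraction when the target has rare states and no
concentration (spiky deviations; few-state toys), while for a switch observable with Gaussian
concentration (many degrees of freedom, local heat-bath sweeps) the supremum sits on smooth,
linear-in-`D` directions and `ρ` is of the order of `λ⋆` (row-19 custody toys, HANDOFF GEN-10).
NOT CLAIMED: any value of `ρ` for a lattice kernel (to be measured or bounded separately);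
non-uniform grids; the optimisation of the Chernoff parameter.
-/

namespace Summit.Ventures.LatticeQCDFlow.Scaling

open Finset
open Literature.Probability.MarkovChains (stepLaw IsStationary)
open Literature.Probability.ImportanceSampling (chiSqDiv chiSqDiv_def chiSqDiv_eq_sum_sq_div)
open Summit.Ventures.LatticeQCDFlow.Exactness
open Summit.Ventures.LatticeQCDFlow.Theory2

variable {X : Type*} [Fintype X] [Nonempty X]

/-! ## §1 The MGF envelope of the dissipated work -/

/-- **THE MGF ENVELOPE WITH THE EXACT PERFECT PART (hypercontractive layers, uniform grid).**
With `ε = σ̄²/n²`, `s = √(e^{t²ε}−1)`, `a = ρ√(e^{(t−1)²ε}−1)`, `θ = ρe^{(6t²−8t+3)ε/4} < 1`: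
`E_F[e^{−t(W − ΔF)}] ≤ exp(Σ_{k<n} Λ_{k/n,1/n}(t)) · exp(n·s·a/(1−θ))` — the perfect-relaxation
value (an explicit equilibrium quantity) times the certified LAG FACTOR. -/
theorem expMoment_work_uniform_le_hc_exact (t : ℝ) (S₀ D : X → ℝ) (P : ℕ → X → X → ℝ) {n : ℕ}
    (hn : n ≠ 0) {ρ σbar : ℝ} (hPpos : ∀ k x y, 0 < P k x y) (hProw : ∀ k x, ∑ y, P k x y = 1)
    (hst : ∀ k, IsStationary (gibbsLaw (linAction S₀ D (((k + 1 : ℕ) : ℝ) / n))) (P k))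
    (hK : ∀ k, HyperContracts (P k) (gibbsLaw (linAction S₀ D (((k + 1 : ℕ) : ℝ) / n))) ρ)
    (hρ : 0 ≤ ρ) (hσ : ∀ c, varD S₀ D c ≤ σbar ^ 2)
    (hθ1 : ρ * Real.exp ((6 * t ^ 2 - 8 * t + 3) * (σbar ^ 2 / n ^ 2) / 4) < 1) :
    ∑ ω : Fin (n + 1) → X,
        pathLaw (gibbsLaw (linAction S₀ D (((0 : ℕ) : ℝ) / n))) (fun k : Fin n => P k) ω
          * Real.exp (-(t * (work (fun k : Fin (n + 1) => linAction S₀ D ((k : ℝ) / n)) ω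
              - (linFreeEnergy S₀ D 1 - linFreeEnergy S₀ D 0))))
      ≤ Real.exp (∑ k ∈ Finset.range n,
            stepLogMGF S₀ D ((k : ℝ) / n) (((k + 1 : ℕ) : ℝ) / n - (k : ℝ) / n) t)
        * Real.exp (n * (Real.sqrt (Real.exp (t ^ 2 * (σbar ^ 2 / n ^ 2)) - 1)
              * (ρ * Real.sqrt (Real.exp ((t - 1) ^ 2 * (σbar ^ 2 / n ^ 2)) - 1))
              / (1 - ρ * Real.exp ((6 * t ^ 2 - 8 * t + 3) * (σbar ^ 2 / n ^ 2) / 4)))) := by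
  set c : ℕ → ℝ := fun k => (k : ℝ) / n with hc
  have hn' : (0 : ℝ) < n := Nat.cast_pos.mpr (Nat.pos_of_ne_zero hn)
  set R : ℝ := n * (Real.sqrt (Real.exp (t ^ 2 * (σbar ^ 2 / n ^ 2)) - 1)
      * (ρ * Real.sqrt (Real.exp ((t - 1) ^ 2 * (σbar ^ 2 / n ^ 2)) - 1))
      / (1 - ρ * Real.exp ((6 * t ^ 2 - 8 * t + 3) * (σbar ^ 2 / n ^ 2) / 4))) with hR
  set ΔF := linFreeEnergy S₀ D 1 - linFreeEnergy S₀ D 0 with hΔF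
  -- E[e^{-t(W-ΔF)}] = e^{tΔF} · |ν_n|
  have hsplit : ∀ ω : Fin (n + 1) → X,
      pathLaw (gibbsLaw (linAction S₀ D (((0 : ℕ) : ℝ) / n))) (fun k : Fin n => P k) ω
          * Real.exp (-(t * (work (fun k : Fin (n + 1) => linAction S₀ D ((k : ℝ) / n)) ω - ΔF)))
        = Real.exp (t * ΔF)
          * (pathLaw (gibbsLaw (linAction S₀ D (c 0))) (fun k : Fin n => P k) ω
            * Real.exp (-(t * work (fun k : Fin (n + 1) => linAction S₀ D (c k)) ω))) := by
    intro ω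
    rw [show -(t * (work (fun k : Fin (n + 1) => linAction S₀ D ((k : ℝ) / n)) ω - ΔF))
        = t * ΔF + -(t * work (fun k : Fin (n + 1) => linAction S₀ D (c k)) ω) by
          rw [hc]; ring, Real.exp_add]
    rw [hc]; ring
  simp_rw [hsplit]
  rw [← mul_sum, sum_pathLaw_exp_neg_mul_work_eq t S₀ D c P n]
  have hmass := tTiltMass_uniform_le_hc t S₀ D P hn hPpos hProw hst hK hρ hσ hθ1
  have hperf := log_tPerfMass_add_eq_sum_stepLogMGF t S₀ D c n
  simp only [hc] at hmass hperf
  rw [show ((n : ℕ) : ℝ) / (n : ℝ) = 1 from div_self hn'.ne',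
    show ((0 : ℕ) : ℝ) / (n : ℝ) = 0 by simp] at hperf
  have hp0 := tPerfMass_pos t S₀ D c n
  simp only [hc] at hp0
  have hpexp : tPerfMass t S₀ D (fun k : ℕ => (k : ℝ) / n) n * Real.exp (t * ΔF)
      = Real.exp (∑ k ∈ Finset.range n,
          stepLogMGF S₀ D ((k : ℝ) / n) (((k + 1 : ℕ) : ℝ) / n - (k : ℝ) / n) t) := by
    rw [← hperf, Real.exp_add, Real.exp_log hp0, hΔF]
  rw [← hR] at hmass
  calc Real.exp (t * ΔF) * ∑ x, tTiltLaw t S₀ D (fun k : ℕ => (k : ℝ) / n) P n x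
      ≤ Real.exp (t * ΔF) * (tPerfMass t S₀ D (fun k : ℕ => (k : ℝ) / n) n * Real.exp R) :=
        mul_le_mul_of_nonneg_left hmass (Real.exp_pos _).le
    _ = Real.exp (∑ k ∈ Finset.range n,
          stepLogMGF S₀ D ((k : ℝ) / n) (((k + 1 : ℕ) : ℝ) / n - (k : ℝ) / n) t) * Real.exp R := by
        rw [← hpexp]; ring

/-- **THE MGF ENVELOPE, HYPERCONTRACTIVE LAYERS (uniform grid, no oscillation hypothesis).**
With `ε = σ̄²/n²`, `s = √(e^{t²ε}−1)`, `a = ρ√(e^{(t−1)²ε}−1)`, `θ = ρe^{(6t²−8t+3)ε/4} < 1`: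
`E_F[e^{−t(W − ΔF)}] ≤ exp(½[t(t−1)]₊·σ̄²/n + n·s·a/(1−θ))`, `ΔF = F(1) − F(0)`
(`n·s·a ≈ ρ|t(t−1)|σ̄²/n`: the Gaussian envelope of variance `2τ̄σ̄²/n` up to `O(σ̄²/n²)`; the
perfect part is `Scaling/LinearFamilyStepMGF.sum_stepLogMGF_uniform_le`). -/
theorem expMoment_work_uniform_le_hc (t : ℝ) (S₀ D : X → ℝ) (P : ℕ → X → X → ℝ) {n : ℕ}
    (hn : n ≠ 0) {ρ σbar : ℝ} (hPpos : ∀ k x y, 0 < P k x y) (hProw : ∀ k x, ∑ y, P k x y = 1)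
    (hst : ∀ k, IsStationary (gibbsLaw (linAction S₀ D (((k + 1 : ℕ) : ℝ) / n))) (P k))
    (hK : ∀ k, HyperContracts (P k) (gibbsLaw (linAction S₀ D (((k + 1 : ℕ) : ℝ) / n))) ρ)
    (hρ : 0 ≤ ρ) (hσ : ∀ c, varD S₀ D c ≤ σbar ^ 2)
    (hθ1 : ρ * Real.exp ((6 * t ^ 2 - 8 * t + 3) * (σbar ^ 2 / n ^ 2) / 4) < 1) :
    ∑ ω : Fin (n + 1) → X,
        pathLaw (gibbsLaw (linAction S₀ D (((0 : ℕ) : ℝ) / n))) (fun k : Fin n => P k) ω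
          * Real.exp (-(t * (work (fun k : Fin (n + 1) => linAction S₀ D ((k : ℝ) / n)) ω
              - (linFreeEnergy S₀ D 1 - linFreeEnergy S₀ D 0))))
      ≤ Real.exp (max (t * (t - 1)) 0 / 2 * (σbar ^ 2 / n)
          + n * (Real.sqrt (Real.exp (t ^ 2 * (σbar ^ 2 / n ^ 2)) - 1)
              * (ρ * Real.sqrt (Real.exp ((t - 1) ^ 2 * (σbar ^ 2 / n ^ 2)) - 1))
              / (1 - ρ * Real.exp ((6 * t ^ 2 - 8 * t + 3) * (σbar ^ 2 / n ^ 2) / 4)))) := by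
  have h := expMoment_work_uniform_le_hc_exact t S₀ D P hn hPpos hProw hst hK hρ hσ hθ1
  have hsum := sum_stepLogMGF_uniform_le t S₀ D hn (σbar := σbar) hσ
  refine h.trans ?_
  rw [Real.exp_add]
  exact mul_le_mul_of_nonneg_right (Real.exp_le_exp.mpr hsum) (Real.exp_pos _).le

/-- The relaxation budget in `σ̄²/n` units: `n·s·a ≤ ρ|t(t−1)|·e^{(2t²−2t+1)σ̄²/(2n²)}·σ̄²/n`. -/
theorem relaxBudget_le (t ρ σbar : ℝ) {n : ℕ} (hn : n ≠ 0) (hρ : 0 ≤ ρ) :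
    (n : ℝ) * (Real.sqrt (Real.exp (t ^ 2 * (σbar ^ 2 / n ^ 2)) - 1)
        * (ρ * Real.sqrt (Real.exp ((t - 1) ^ 2 * (σbar ^ 2 / n ^ 2)) - 1)))
      ≤ ρ * |t * (t - 1)| * Real.exp ((2 * t ^ 2 - 2 * t + 1) * (σbar ^ 2 / n ^ 2) / 2)
          * (σbar ^ 2 / n) := by
  have hn' : (0 : ℝ) < n := Nat.cast_pos.mpr (Nat.pos_of_ne_zero hn)
  set ε := σbar ^ 2 / n ^ 2 with hε
  have hε0 : 0 ≤ ε := by positivity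
  have hA := Literature.Analysis.ODE.exp_sub_one_le_mul_exp (t ^ 2 * ε)
  have hB := Literature.Analysis.ODE.exp_sub_one_le_mul_exp ((t - 1) ^ 2 * ε)
  have hsA : Real.sqrt (Real.exp (t ^ 2 * ε) - 1) ≤ |t| * Real.sqrt ε * Real.exp (t ^ 2 * ε / 2) := by
    have h0 : 0 ≤ |t| * Real.sqrt ε * Real.exp (t ^ 2 * ε / 2) := by positivity
    refine Real.sqrt_le_iff.mpr ⟨h0, hA.trans (le_of_eq ?_)⟩
    rw [mul_pow, mul_pow, sq_abs, Real.sq_sqrt hε0, ← Real.exp_nat_mul]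
    congr 1; push_cast; ring
  have hsB : Real.sqrt (Real.exp ((t - 1) ^ 2 * ε) - 1)
      ≤ |t - 1| * Real.sqrt ε * Real.exp ((t - 1) ^ 2 * ε / 2) := by
    have h0 : 0 ≤ |t - 1| * Real.sqrt ε * Real.exp ((t - 1) ^ 2 * ε / 2) := by positivity
    refine Real.sqrt_le_iff.mpr ⟨h0, hB.trans (le_of_eq ?_)⟩
    rw [mul_pow, mul_pow, sq_abs, Real.sq_sqrt hε0, ← Real.exp_nat_mul]
    congr 1; push_cast; ring
  have hprod := mul_le_mul hsA (mul_le_mul_of_nonneg_left hsB hρ) (by positivity) (by positivity)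
  have e : |t| * Real.sqrt ε * Real.exp (t ^ 2 * ε / 2)
        * (ρ * (|t - 1| * Real.sqrt ε * Real.exp ((t - 1) ^ 2 * ε / 2)))
      = ρ * |t * (t - 1)| * Real.exp ((2 * t ^ 2 - 2 * t + 1) * ε / 2) * (ε * 1) := by
    rw [abs_mul, show ε * 1 = Real.sqrt ε ^ 2 by rw [Real.sq_sqrt hε0, mul_one],
      show (2 * t ^ 2 - 2 * t + 1) * ε / 2 = t ^ 2 * ε / 2 + (t - 1) ^ 2 * ε / 2 by ring,
      Real.exp_add]
    ring
  rw [e] at hprod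
  have hεn : (n : ℝ) * (ε * 1) = σbar ^ 2 / n := by rw [hε]; field_simp
  calc (n : ℝ) * (Real.sqrt (Real.exp (t ^ 2 * ε) - 1)
          * (ρ * Real.sqrt (Real.exp ((t - 1) ^ 2 * ε) - 1)))
      ≤ (n : ℝ) * (ρ * |t * (t - 1)| * Real.exp ((2 * t ^ 2 - 2 * t + 1) * ε / 2) * (ε * 1)) :=
        mul_le_mul_of_nonneg_left hprod hn'.le
    _ = _ := by rw [← hεn]; ring

/-- **LOWER TAIL OF THE WORK (second-law "violations"), hypercontractive layers.**  For `t ≥ 0`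
with `θ_t < 1`: `P_F(W − ΔF ≤ −x) ≤ e^{−t·x} · exp(½[t(t−1)]₊σ̄²/n + n·s·a/(1−θ_t))`
(Chernoff entry point of `Scaling/PathWorkMoments`; at `t = 1` the classical `e^{−x}` up to the
zero relaxation term `a = 0`). -/
theorem lowerTail_work_le_hc (S₀ D : X → ℝ) (P : ℕ → X → X → ℝ) {n : ℕ} (hn : n ≠ 0)
    {ρ σbar t : ℝ} (x : ℝ) (hPpos : ∀ k x y, 0 < P k x y) (hProw : ∀ k x, ∑ y, P k x y = 1)
    (hst : ∀ k, IsStationary (gibbsLaw (linAction S₀ D (((k + 1 : ℕ) : ℝ) / n))) (P k))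
    (hK : ∀ k, HyperContracts (P k) (gibbsLaw (linAction S₀ D (((k + 1 : ℕ) : ℝ) / n))) ρ)
    (hρ : 0 ≤ ρ) (hσ : ∀ c, varD S₀ D c ≤ σbar ^ 2) (ht : 0 ≤ t)
    (hθ1 : ρ * Real.exp ((6 * t ^ 2 - 8 * t + 3) * (σbar ^ 2 / n ^ 2) / 4) < 1) :
    ∑ ω : Fin (n + 1) → X,
        (if x ≤ -(work (fun k : Fin (n + 1) => linAction S₀ D ((k : ℝ) / n)) ω
              - (linFreeEnergy S₀ D 1 - linFreeEnergy S₀ D 0))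
          then pathLaw (gibbsLaw (linAction S₀ D (((0 : ℕ) : ℝ) / n))) (fun k : Fin n => P k) ω
          else 0)
      ≤ Real.exp (-(t * x)) * Real.exp (max (t * (t - 1)) 0 / 2 * (σbar ^ 2 / n)
          + n * (Real.sqrt (Real.exp (t ^ 2 * (σbar ^ 2 / n ^ 2)) - 1)
              * (ρ * Real.sqrt (Real.exp ((t - 1) ^ 2 * (σbar ^ 2 / n ^ 2)) - 1))
              / (1 - ρ * Real.exp ((6 * t ^ 2 - 8 * t + 3) * (σbar ^ 2 / n ^ 2) / 4)))) := by
  have hPω : ∀ ω : Fin (n + 1) → X,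
      0 ≤ pathLaw (gibbsLaw (linAction S₀ D (((0 : ℕ) : ℝ) / n))) (fun k : Fin n => P k) ω :=
    fun ω => (pathLaw_pos (gibbsLaw_pos _) (fun k x y => hPpos k x y) ω).le
  have hmk := sum_ite_le_exp_mul_sum hPω
    (fun ω => -(work (fun k : Fin (n + 1) => linAction S₀ D ((k : ℝ) / n)) ω
      - (linFreeEnergy S₀ D 1 - linFreeEnergy S₀ D 0))) x ht
  have hmgf := expMoment_work_uniform_le_hc t S₀ D P hn hPpos hProw hst hK hρ hσ hθ1
  refine hmk.trans (mul_le_mul_of_nonneg_left ?_ (Real.exp_pos _).le)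
  refine le_of_eq_of_le (sum_congr rfl fun ω _ => ?_) hmgf
  congr 2; ring

/-- **UPPER TAIL OF THE WORK, hypercontractive layers.**  For `s ≥ 0` with `θ_{−s} < 1`:
`P_F(W − ΔF ≥ x) ≤ e^{−s·x} · exp(½s(s+1)σ̄²/n + n·s'·a'/(1−θ_{−s}))` (the envelope at
`t = −s`). -/
theorem upperTail_work_le_hc (S₀ D : X → ℝ) (P : ℕ → X → X → ℝ) {n : ℕ} (hn : n ≠ 0)
    {ρ σbar s : ℝ} (x : ℝ) (hPpos : ∀ k x y, 0 < P k x y) (hProw : ∀ k x, ∑ y, P k x y = 1)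
    (hst : ∀ k, IsStationary (gibbsLaw (linAction S₀ D (((k + 1 : ℕ) : ℝ) / n))) (P k))
    (hK : ∀ k, HyperContracts (P k) (gibbsLaw (linAction S₀ D (((k + 1 : ℕ) : ℝ) / n))) ρ)
    (hρ : 0 ≤ ρ) (hσ : ∀ c, varD S₀ D c ≤ σbar ^ 2) (hs : 0 ≤ s)
    (hθ1 : ρ * Real.exp ((6 * (-s) ^ 2 - 8 * (-s) + 3) * (σbar ^ 2 / n ^ 2) / 4) < 1) :
    ∑ ω : Fin (n + 1) → X,
        (if x ≤ work (fun k : Fin (n + 1) => linAction S₀ D ((k : ℝ) / n)) ω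
              - (linFreeEnergy S₀ D 1 - linFreeEnergy S₀ D 0)
          then pathLaw (gibbsLaw (linAction S₀ D (((0 : ℕ) : ℝ) / n))) (fun k : Fin n => P k) ω
          else 0)
      ≤ Real.exp (-(s * x)) * Real.exp (max ((-s) * ((-s) - 1)) 0 / 2 * (σbar ^ 2 / n)
          + n * (Real.sqrt (Real.exp ((-s) ^ 2 * (σbar ^ 2 / n ^ 2)) - 1)
              * (ρ * Real.sqrt (Real.exp (((-s) - 1) ^ 2 * (σbar ^ 2 / n ^ 2)) - 1))
              / (1 - ρ * Real.exp ((6 * (-s) ^ 2 - 8 * (-s) + 3) * (σbar ^ 2 / n ^ 2) / 4)))) := by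
  have hPω : ∀ ω : Fin (n + 1) → X,
      0 ≤ pathLaw (gibbsLaw (linAction S₀ D (((0 : ℕ) : ℝ) / n))) (fun k : Fin n => P k) ω :=
    fun ω => (pathLaw_pos (gibbsLaw_pos _) (fun k x y => hPpos k x y) ω).le
  have hmk := sum_ite_le_exp_mul_sum hPω
    (fun ω => work (fun k : Fin (n + 1) => linAction S₀ D ((k : ℝ) / n)) ω
      - (linFreeEnergy S₀ D 1 - linFreeEnergy S₀ D 0)) x hs
  have hmgf := expMoment_work_uniform_le_hc (-s) S₀ D P hn hPpos hProw hst hK hρ hσ hθ1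
  refine hmk.trans (mul_le_mul_of_nonneg_left ?_ (Real.exp_pos _).le)
  refine le_of_eq_of_le (sum_congr rfl fun ω _ => ?_) hmgf
  congr 2; ring

/-! ## §2 The ESS floor -/

/-- **THE ESS FLOOR IN `2τ̄` FORM, HYPERCONTRACTIVE LAYERS (no oscillation hypothesis).**
`exp(−((1+θ)/(1−θ))·σ̄²/n) ≤ ÊSS`, `θ = ρ·e^{11σ̄²/(4n²)} < 1` — E7's `k′ = 2τ_intσ²` law as a
certified envelope whose only correction to `ρ` is `e^{11σ̄²/(4n²)}`. -/
theorem exp_le_ess_path_uniform_hc (S₀ D : X → ℝ) (P : ℕ → X → X → ℝ) {n : ℕ} (hn : n ≠ 0)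
    {ρ σbar : ℝ} (hPpos : ∀ k x y, 0 < P k x y) (hProw : ∀ k x, ∑ y, P k x y = 1)
    (hst : ∀ k, IsStationary (gibbsLaw (linAction S₀ D (((k + 1 : ℕ) : ℝ) / n))) (P k))
    (hK : ∀ k, HyperContracts (P k) (gibbsLaw (linAction S₀ D (((k + 1 : ℕ) : ℝ) / n))) ρ)
    (hρ : 0 ≤ ρ) (hσ : ∀ c, varD S₀ D c ≤ σbar ^ 2)
    (hθ1 : ρ * Real.exp (11 * (σbar ^ 2 / n ^ 2) / 4) < 1) :
    Real.exp (-((1 + ρ * Real.exp (11 * (σbar ^ 2 / n ^ 2) / 4))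
        / (1 - ρ * Real.exp (11 * (σbar ^ 2 / n ^ 2) / 4)) * (σbar ^ 2 / n)))
      ≤ essFrac (revPathLaw (fun k : Fin (n + 1) => linAction S₀ D ((k : ℝ) / n))
            (fun k : Fin n => P k))
          (pathLaw (gibbsLaw (linAction S₀ D (((0 : Fin (n + 1)) : ℝ) / n))) (fun k : Fin n => P k)) := by
  have hn' : (0 : ℝ) < n := Nat.cast_pos.mpr (Nat.pos_of_ne_zero hn)
  have h1θ : 0 < 1 - ρ * Real.exp (11 * (σbar ^ 2 / n ^ 2) / 4) := by linarith
  -- the t = 2 exponential moment and its relaxation budget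
  have h11 : (6 * (2:ℝ) ^ 2 - 8 * 2 + 3) * (σbar ^ 2 / n ^ 2) / 4 = 11 * (σbar ^ 2 / n ^ 2) / 4 := by
    ring
  have hθ1' : ρ * Real.exp ((6 * (2:ℝ) ^ 2 - 8 * 2 + 3) * (σbar ^ 2 / n ^ 2) / 4) < 1 := by
    rwa [h11]
  have hmgf := expMoment_work_uniform_le_hc 2 S₀ D P hn hPpos hProw hst hK hρ hσ hθ1'
  rw [h11, show (2:ℝ) * (2 - 1) = 2 by norm_num, max_eq_left (by norm_num : (0:ℝ) ≤ 2)] at hmgf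
  have hbud := relaxBudget_le 2 ρ σbar hn hρ
  rw [show (2 * (2:ℝ) ^ 2 - 2 * 2 + 1) * (σbar ^ 2 / n ^ 2) / 2 = 5 * (σbar ^ 2 / n ^ 2) / 2 by ring,
    show |(2:ℝ) * (2 - 1)| = 2 by norm_num] at hbud
  have hexp : Real.exp (5 * (σbar ^ 2 / n ^ 2) / 2) ≤ Real.exp (11 * (σbar ^ 2 / n ^ 2) / 4) :=
    Real.exp_le_exp.mpr (by nlinarith [show 0 ≤ σbar ^ 2 / n ^ 2 by positivity])
  have hV0 : 0 ≤ σbar ^ 2 / n := by positivity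
  have hbud2 : (n : ℝ) * (Real.sqrt (Real.exp (2 ^ 2 * (σbar ^ 2 / n ^ 2)) - 1)
        * (ρ * Real.sqrt (Real.exp ((2 - 1) ^ 2 * (σbar ^ 2 / n ^ 2)) - 1)))
      ≤ 2 * (ρ * Real.exp (11 * (σbar ^ 2 / n ^ 2) / 4)) * (σbar ^ 2 / n) := by
    refine hbud.trans ?_
    have h1 := mul_le_mul_of_nonneg_left hexp hρ
    nlinarith [mul_le_mul_of_nonneg_right h1 hV0]
  -- the path-space identity 1/ÊSS = E_F[e^{-2(W-ΔF)}]
  set S : Fin (n + 1) → X → ℝ := fun k => linAction S₀ D ((k : ℝ) / n) with hS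
  have hP' : ∀ (k : Fin n) x y, 0 < (fun k : Fin n => P k) k x y := fun k x y => hPpos k x y
  have hst' : ∀ k : Fin n, IsStationary (fun x => Real.exp (-(S k.succ x)))
      ((fun k : Fin n => P k) k) := by
    intro k
    have h := isStationary_exp_neg_of_gibbsLaw (hst k)
    simpa only [hS, Fin.val_succ] using h
  have hid := inv_essFrac_path_eq_sum_exp_two S hP' hst'
  have hSlast : freeEnergy (S (Fin.last n)) = linFreeEnergy S₀ D 1 := by
    rw [hS, linFreeEnergy]; simp only [Fin.val_last]; rw [div_self hn'.ne']
  have hS0' : freeEnergy (S 0) = linFreeEnergy S₀ D 0 := by rw [hS, linFreeEnergy]; simp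
  have hS0'' : gibbsLaw (S 0) = gibbsLaw (linAction S₀ D (((0 : ℕ) : ℝ) / n)) := by
    rw [hS]; simp
  rw [hSlast, hS0', hS0''] at hid
  rw [← hid] at hmgf
  have hE0 : 0 < essFrac (revPathLaw S (fun k : Fin n => P k))
      (pathLaw (gibbsLaw (S 0)) (fun k : Fin n => P k)) :=
    essFrac_pos (pathLaw_pos (gibbsLaw_pos _) hP') (sum_revPathLaw _ _ hst')
  -- 1/E ≤ exp(B') with B' ≤ B ⇒ exp(-B) ≤ E
  rw [Real.exp_neg, inv_le_comm₀ (Real.exp_pos _) hE0]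
  refine hmgf.trans (Real.exp_le_exp.mpr ?_)
  have hre : (n : ℝ) * (Real.sqrt (Real.exp (2 ^ 2 * (σbar ^ 2 / n ^ 2)) - 1)
      * (ρ * Real.sqrt (Real.exp ((2 - 1) ^ 2 * (σbar ^ 2 / n ^ 2)) - 1))
      / (1 - ρ * Real.exp (11 * (σbar ^ 2 / n ^ 2) / 4)))
      = (n : ℝ) * (Real.sqrt (Real.exp (2 ^ 2 * (σbar ^ 2 / n ^ 2)) - 1)
        * (ρ * Real.sqrt (Real.exp ((2 - 1) ^ 2 * (σbar ^ 2 / n ^ 2)) - 1)))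
        / (1 - ρ * Real.exp (11 * (σbar ^ 2 / n ^ 2) / 4)) := (mul_div_assoc _ _ _).symm
  rw [hre]
  generalize hN : (n : ℝ) * (Real.sqrt (Real.exp (2 ^ 2 * (σbar ^ 2 / n ^ 2)) - 1)
      * (ρ * Real.sqrt (Real.exp ((2 - 1) ^ 2 * (σbar ^ 2 / n ^ 2)) - 1))) = N at hbud2 ⊢
  generalize hq : ρ * Real.exp (11 * (σbar ^ 2 / n ^ 2) / 4) = θ at hbud2 h1θ ⊢
  generalize hV : σbar ^ 2 / (n : ℝ) = V at hbud2 hV0 ⊢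
  have hdiv : N / (1 - θ) ≤ 2 * θ * V / (1 - θ) := div_le_div_of_nonneg_right hbud2 h1θ.le
  have hfin : (1 + θ) / (1 - θ) * V = 2 / 2 * V + 2 * θ * V / (1 - θ) := by
    field_simp
    ring
  rw [hfin]
  linarith

/-! ## §3 The mean work -/

/-- **E7's MEAN-WORK LAW FROM VARIANCES ALONE (hypercontractive layers).**  For every `u > 0` with
`θ_{−u} = ρe^{(6u²+8u+3)ε/4} < 1` (Jensen `e^{u(⟨W⟩−ΔF)} ≤ E_F e^{u(W−ΔF)}` and the envelope at
`t = −u`): `⟨W⟩ − ΔF ≤ (1/u)·(½u(u+1)σ̄²/n + n·√(e^{u²ε}−1)·ρ√(e^{(u+1)²ε}−1)/(1−θ_{−u}))`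
`≈ (1+u)·τ̄σ̄²/n`, `τ̄ = ½(1+ρ)/(1−ρ)`: no sub-Gaussian envelope and no oscillation hypothesis (the
entropy route of `Scaling/EntropyE7Envelope` needed a log-MGF envelope of `D`). -/
theorem meanWork_sub_freeEnergy_le_hc (S₀ D : X → ℝ) (P : ℕ → X → X → ℝ) {n : ℕ} (hn : n ≠ 0)
    {ρ σbar u : ℝ} (hPpos : ∀ k x y, 0 < P k x y) (hProw : ∀ k x, ∑ y, P k x y = 1)
    (hst : ∀ k, IsStationary (gibbsLaw (linAction S₀ D (((k + 1 : ℕ) : ℝ) / n))) (P k))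
    (hK : ∀ k, HyperContracts (P k) (gibbsLaw (linAction S₀ D (((k + 1 : ℕ) : ℝ) / n))) ρ)
    (hρ : 0 ≤ ρ) (hσ : ∀ c, varD S₀ D c ≤ σbar ^ 2) (hu : 0 < u)
    (hθ1 : ρ * Real.exp ((6 * (-u) ^ 2 - 8 * (-u) + 3) * (σbar ^ 2 / n ^ 2) / 4) < 1) :
    ∑ ω : Fin (n + 1) → X,
        pathLaw (gibbsLaw (linAction S₀ D (((0 : ℕ) : ℝ) / n))) (fun k : Fin n => P k) ω
          * work (fun k : Fin (n + 1) => linAction S₀ D ((k : ℝ) / n)) ω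
        - (linFreeEnergy S₀ D 1 - linFreeEnergy S₀ D 0)
      ≤ (1 / u) * (max ((-u) * ((-u) - 1)) 0 / 2 * (σbar ^ 2 / n)
          + n * (Real.sqrt (Real.exp ((-u) ^ 2 * (σbar ^ 2 / n ^ 2)) - 1)
              * (ρ * Real.sqrt (Real.exp (((-u) - 1) ^ 2 * (σbar ^ 2 / n ^ 2)) - 1))
              / (1 - ρ * Real.exp ((6 * (-u) ^ 2 - 8 * (-u) + 3) * (σbar ^ 2 / n ^ 2) / 4)))) := by
  set μ : (Fin (n + 1) → X) → ℝ :=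
    fun ω => pathLaw (gibbsLaw (linAction S₀ D (((0 : ℕ) : ℝ) / n))) (fun k : Fin n => P k) ω
    with hμ
  set Wd : (Fin (n + 1) → X) → ℝ := fun ω =>
    work (fun k : Fin (n + 1) => linAction S₀ D ((k : ℝ) / n)) ω
      - (linFreeEnergy S₀ D 1 - linFreeEnergy S₀ D 0) with hWd
  set B : ℝ := max ((-u) * ((-u) - 1)) 0 / 2 * (σbar ^ 2 / n)
      + n * (Real.sqrt (Real.exp ((-u) ^ 2 * (σbar ^ 2 / n ^ 2)) - 1)
          * (ρ * Real.sqrt (Real.exp (((-u) - 1) ^ 2 * (σbar ^ 2 / n ^ 2)) - 1))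
          / (1 - ρ * Real.exp ((6 * (-u) ^ 2 - 8 * (-u) + 3) * (σbar ^ 2 / n ^ 2) / 4))) with hB
  obtain ⟨hnn, hsum⟩ := pathLaw_nonneg_sum_eq_one (P := fun k : Fin n => P k)
    (fun x => (gibbsLaw_pos (linAction S₀ D (((0 : ℕ) : ℝ) / n)) x).le) (sum_gibbsLaw _)
    (fun k => ⟨fun x y => (hPpos k x y).le, hProw k⟩)
  -- Jensen for exp and the linear map w ↦ u·w
  have hj := (convexOn_exp.comp_linearMap (u • LinearMap.id : ℝ →ₗ[ℝ] ℝ)).map_sum_le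
    (t := univ) (w := μ) (p := Wd) (fun ω _ => hnn ω) hsum (fun ω _ => Set.mem_univ _)
  simp only [Function.comp, LinearMap.smul_apply, LinearMap.id_apply, smul_eq_mul] at hj
  -- the envelope at t = -u
  have hmgf := expMoment_work_uniform_le_hc (-u) S₀ D P hn hPpos hProw hst hK hρ hσ hθ1
  rw [← hB] at hmgf
  have hmgf' : ∑ ω, μ ω * Real.exp (u * Wd ω) ≤ Real.exp B := by
    refine le_of_eq_of_le (sum_congr rfl fun ω _ => ?_) hmgf
    rw [hμ, hWd]; congr 2; ring
  have hlog := Real.log_le_log (Real.exp_pos _) (hj.trans hmgf')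
  rw [Real.log_exp, Real.log_exp] at hlog
  -- Σ μ·Wd = Σ μ·W − ΔF
  have hsum' : ∑ ω, μ ω = 1 := hsum
  have hlin : ∑ ω, μ ω * Wd ω
      = ∑ ω, μ ω * work (fun k : Fin (n + 1) => linAction S₀ D ((k : ℝ) / n)) ω
        - (linFreeEnergy S₀ D 1 - linFreeEnergy S₀ D 0) := by
    rw [hWd]; simp only [mul_sub, sum_sub_distrib, ← sum_mul, hsum']; ring
  rw [← hlin]
  calc ∑ ω, μ ω * Wd ω = (1 / u) * (u * ∑ ω, μ ω * Wd ω) := by field_simp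
    _ ≤ (1 / u) * B := mul_le_mul_of_nonneg_left hlog (by positivity)

end Summit.Ventures.LatticeQCDFlow.Scaling
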